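import Literature.Computability.Cryptography.CryptoFoundationsWave0
import HarnessLib

/-!
# Crypto foundations — Wave 0 statements: discharged facts

Proof of the one named fact of `Literature.Computability.Cryptography.CryptoFoundationsWave0`
(**crypto-foundations.S03**), kept in a sibling file so that the statement file stays a
definitions/named-facts file:

* `isNegligible_iff_textbook_holds : isNegligible_iff_textbook` — Mathlib's
  `Asymptotics.SuperpolynomialDecay atTop (fun n : ℕ => (n : ℝ)) μ` (i.e. `∀ c, n ^ c * μ n → 0`)
  coincides with the textbook `∀ c ∃ N ∀ n > N, |μ n| < n ^ (-c)` form of a negligible function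
  (Goldreich, *Foundations of Cryptography* vol. 1, Definition 1.3.5: "we call a function
  `μ : ℕ → ℝ` negligible if for every positive polynomial `p(·)` there exists an `N` such that for
  all `n > N`, `μ(n) < 1/p(n)`"). The proof is the elementary `ε/N` argument:
  (→) `n ^ c * μ n → 0` gives eventually `|n ^ c * μ n| < 1`, i.e. `|μ n| < n ^ (-c)` once
  `n > N ≥ 0`; (←) from `|μ n| < n ^ (-(c+1))` for `n > N` we get `0 ≤ |n ^ c * μ n| ≤ n⁻¹ → 0`
  and conclude by squeezing.

## References

* O. Goldreich, *Foundations of Cryptography. Volume 1: Basic Tools*, Cambridge University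
  Press 2001, §1.3 (Definition 1.3.5, negligible functions). doi:10.1017/cbo9780511546891
-/

namespace Literature.Computability.Cryptography

open Filter Asymptotics

/-- **Discharge of `isNegligible_iff_textbook`** (crypto-foundations.S03; Goldreich,
*Foundations of Cryptography* vol. 1, Definition 1.3.5 and the discussion following it):
for every `μ : ℕ → ℝ`, `IsNegligible μ ↔ IsNegligibleTextbook μ`, i.e. Mathlib's
superpolynomial-decay predicate at parameter `n ↦ (n : ℝ)` is the textbook
`∀ c ∃ N ∀ n > N, |μ n| < n ^ (-c)` definition of a negligible function.
[cite: Goldreich2001, Def. 1.3.5] -/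
theorem isNegligible_iff_textbook_holds : isNegligible_iff_textbook := by
  intro μ
  constructor
  · -- Mathlib form ⇒ textbook form
    intro h c
    have ht : Tendsto (fun n : ℕ => |(n : ℝ) ^ c * μ n|) atTop (nhds 0) :=
      (tendsto_zero_iff_abs_tendsto_zero _).1 (h c)
    have hev : ∀ᶠ n : ℕ in atTop, |(n : ℝ) ^ c * μ n| < 1 :=
      ht.eventually (gt_mem_nhds zero_lt_one)
    obtain ⟨N, hN⟩ := eventually_atTop.1 hev
    refine ⟨N, fun n hn => ?_⟩
    have hn0 : (0 : ℝ) < n := by exact_mod_cast Nat.lt_of_le_of_lt (Nat.zero_le N) hn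
    have hpow : (0 : ℝ) < (n : ℝ) ^ c := pow_pos hn0 c
    have h1 : |(n : ℝ) ^ c * μ n| < 1 := hN n hn.le
    rw [abs_mul, abs_of_pos hpow, mul_comm] at h1
    rw [zpow_neg, zpow_natCast, inv_eq_one_div, lt_div_iff₀ hpow]
    exact h1
  · -- textbook form ⇒ Mathlib form
    intro h c
    obtain ⟨N, hN⟩ := h (c + 1)
    rw [tendsto_zero_iff_abs_tendsto_zero]
    have h0 : Tendsto (fun _ : ℕ => (0 : ℝ)) atTop (nhds 0) := tendsto_const_nhds
    have h1 : Tendsto (fun n : ℕ => ((n : ℝ))⁻¹) atTop (nhds 0) :=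
      tendsto_inv_atTop_zero.comp tendsto_natCast_atTop_atTop
    refine tendsto_of_tendsto_of_tendsto_of_le_of_le' h0 h1
      (Eventually.of_forall fun n => abs_nonneg _) ?_
    rw [eventually_atTop]
    refine ⟨N + 1, fun n hn => ?_⟩
    have hNn : N < n := Nat.lt_of_lt_of_le (Nat.lt_succ_self N) hn
    have hn0 : (0 : ℝ) < n := by exact_mod_cast Nat.lt_of_le_of_lt (Nat.zero_le N) hNn
    have hpow : (0 : ℝ) < (n : ℝ) ^ c := pow_pos hn0 c
    have hμ : |μ n| ≤ (n : ℝ) ^ (-((c + 1 : ℕ) : ℤ)) := (hN n hNn).le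
    calc |(n : ℝ) ^ c * μ n| = (n : ℝ) ^ c * |μ n| := by rw [abs_mul, abs_of_pos hpow]
      _ ≤ (n : ℝ) ^ c * (n : ℝ) ^ (-((c + 1 : ℕ) : ℤ)) :=
          mul_le_mul_of_nonneg_left hμ hpow.le
      _ = ((n : ℝ))⁻¹ := by
          rw [zpow_neg, zpow_natCast, pow_succ, mul_inv, ← mul_assoc, mul_inv_cancel₀ hpow.ne',
            one_mul]

end Literature.Computability.Cryptography
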